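import Mathlib.RingTheory.Localization.FractionRing
import Mathlib.RingTheory.Ideal.Maximal
import Literature.Computability.AlgebraicComplexity.ZariskiClosureBaseChange
import HarnessLib

/-!
# Polystability (closed `SL`-orbit) is invariant under extension of algebraically closed scalars
# (the algebraic Lefschetz principle, part II)

Sequel of `ZariskiClosureBaseChange.lean` (THEOREMS ONLY, plus one bookkeeping `def`). For a
polynomial `f` over an algebraically closed field `k` and a field extension `k → K`:

* § 1 `degreeSupportMonomials f` (the monomials whose degree occurs in `f`): off this finite set every
  `SL`/`GL`-translate of `f` and every point of the Zariski closure of the orbit has vanishing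
  coordinates — the reduction of orbit questions to finitely many coordinates.
* § 2 **density**: a polynomial over `k` vanishing on `SL_n(k) · f` has base change vanishing on
  `SL_n(K) · f_K` (`aeval_map_eq_zero_of_forall_slOrbit`; `SL_n(k)` is Zariski dense in `SL_n`,
  via the Nullstellensatz over the algebraically closed `k`).
* § 3 **descent** `IsPolystable.of_map`: `f_K` polystable ⇒ `f` polystable (an `SL`-system over
  `k` with a solution over `K` has one over `k`: weak Nullstellensatz).
* § 4 **the generic point specialises** (`exists_aeval_eq_of_forall_lift`): pure commutative
  algebra — for `w : T → K` (`K` algebraically closed) and an incidence ideal over `k` in variables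
  `T ⊕ τ` of the shape `{g = 0 (g ∈ G₀), Y_d = c_d}`, if every `k`-specialisation of `w` lifts to
  a `k`-point of the incidence ideal then `w` itself lifts to a `K`-point. Proof: the prime
  `𝔭 = ker(ev_w)` lifts to a prime `𝔔` of the incidence ring (`Ideal.exists_le_prime_disjoint`;
  disjointness is the lifting hypothesis read through `IsPrime.vanishingIdeal_zeroLocus`), the
  residue domains embed `k[T]/𝔭 ↪ k[T ⊕ τ]/𝔔` and `k[T]/𝔭 ↪ K`, and over the fraction field `M`
  of `k[T]/𝔭` the fibre ideal has a point in `Frac(k[T ⊕ τ]/𝔔)`, hence is proper, hence has a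
  `K`-point by the Nullstellensatz over `M` with points in `K` (Mathlib's relative form).
* § 5 **ascent** `IsPolystable.map`: `f` polystable over `k` ⇒ `f_K` polystable over every
  ALGEBRAICALLY CLOSED `K ⊇ k` (§ 4 applied to the incidence ideal `{det Y = 1, Y·f = w}`; the
  lifting hypothesis is polystability over `k` plus § 2).

Classical content: the closedness of an orbit of a `k`-group acting on a `k`-variety is insensitive
to extension of the algebraically closed base field (Mumford–Fogarty–Kirwan, GIT, Ch. 1 §1 with
Ch. 0 §2 (iv) "geometric" notions; Milne, Algebraic Groups, Prop. 1.11 / Cor. 1.17 / A.48 for the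
density inputs). Honest framing: bookkeeping for the cell's literature ledger (row MS2001-A,
fact `MS2001_thm_5_1`); nothing here bears on VP versus VNP.

## References

* D. Mumford, J. Fogarty, F. Kirwan, *Geometric Invariant Theory*, 3rd ed. (1994), Ch. 0 §2,
  Ch. 1 §1. [MumfordFogartyKirwan1994]
* J. S. Milne, *Algebraic Groups*, CUP (2017), Prop. 1.11, Cor. 1.17, A.48 (held text
  `book:milnend-algebraic-groups` p0096–p0097, p0625). [Milne2017AlgebraicGroups]
* M. F. Atiyah, I. G. Macdonald, *Introduction to Commutative Algebra* (1969), Thm. 5.10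
  (lying over), Cor. 7.10, Ex. 7.14 (Nullstellensatz). [AtiyahMacdonald1969]

## Provenance

Cell `val-lit`, seat `val-lit-x3` generation 5 (programme #10, lead-bip RULING 2026-08-27 11:03Z).
-/

noncomputable section

open MvPolynomial

namespace Literature.Computability.AlgebraicComplexity

/-! ### § 1 The finitely many coordinates that matter -/

section Support

variable {k : Type*} [Field k] {σ : Type*} [Fintype σ] [DecidableEq σ]

/-- The monomials whose total degree is the degree of some monomial of `f` — a finite set of
coordinates of coefficient space outside which `f`, all its linear substitutes and every point of
the Zariski closure of its orbit vanish. [folklore] -/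
def degreeSupportMonomials (f : MvPolynomial σ k) : Finset (σ →₀ ℕ) :=
  f.support.biUnion fun e => (Finset.univ : Finset σ).finsuppAntidiag e.degree

/-- Membership in `univ.finsuppAntidiag n` is "total degree `= n`". [folklore] -/
private theorem mem_finsuppAntidiag_univ_iff_totalDegree {n : ℕ} {e : σ →₀ ℕ} :
    e ∈ (Finset.univ : Finset σ).finsuppAntidiag n ↔ e.degree = n := by
  simp [Finset.mem_finsuppAntidiag, Finsupp.degree_eq_sum]

/-- A monomial with the degree of a monomial of `f` belongs to `degreeSupportMonomials f`. [folklore] -/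
private theorem mem_degreeSupportMonomials_of_degree_eq {f : MvPolynomial σ k} {d e : σ →₀ ℕ}
    (he : e ∈ f.support) (hde : e.degree = d.degree) : d ∈ degreeSupportMonomials f := by
  rw [degreeSupportMonomials, Finset.mem_biUnion]
  exact ⟨e, he, mem_finsuppAntidiag_univ_iff_totalDegree.mpr hde.symm⟩

/-- **Off `degreeSupportMonomials f` every linear substitute of `f` has zero coefficient** (the action
preserves each degree). [cite: MulmuleySohoniSIAM2001, §4 (`GL` acts on `V = Sym^m`)] -/
theorem coeff_linSubst_eq_zero_of_notMem {f : MvPolynomial σ k} {d : σ →₀ ℕ}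
    (hd : d ∉ degreeSupportMonomials f) (B : Matrix σ σ k) : coeff d (linSubst σ k B f) = 0 := by
  rw [coeff_linSubst_eq_sum_finsuppAntidiag]
  refine Finset.sum_eq_zero fun e he => ?_
  have hdeg : e.degree = d.degree := mem_finsuppAntidiag_univ_iff_totalDegree.mp he
  have hcoeff : coeff e f = 0 := by
    by_contra h
    exact hd (mem_degreeSupportMonomials_of_degree_eq (mem_support_iff.mpr h) hdeg)
  rw [hcoeff, zero_mul]

/-- `degreeSupportMonomials` is invariant under extension of scalars (the support of a polynomial is
unchanged by an injective change of coefficients). [cite: Milne2017AlgebraicGroups, §1.e (extension of scalars)] -/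
theorem degreeSupportMonomials_map {K : Type*} [Field K] [Algebra k K] (f : MvPolynomial σ k) :
    degreeSupportMonomials (map (algebraMap k K) f) = degreeSupportMonomials f := by
  rw [degreeSupportMonomials, degreeSupportMonomials, support_map_of_injective _ (algebraMap k K).injective]

/-- **Off `degreeSupportMonomials f` every point of the Zariski closure of `coeffVec '' (SL · f)`
vanishes** (the coordinate function `X_d` vanishes on the orbit).
[cite: MulmuleySohoniSIAM2001, §4 (`GL` acts on `V = Sym^m`)] -/
theorem apply_eq_zero_of_mem_zariskiClosure_slOrbit {f : MvPolynomial σ k} {v : (σ →₀ ℕ) → k}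
    (hv : v ∈ zariskiClosure (coeffVec '' slOrbit σ k f)) {d : σ →₀ ℕ}
    (hd : d ∉ degreeSupportMonomials f) : v d = 0 := by
  rw [mem_zariskiClosure_iff] at hv
  have h := hv (X d) (by
    rintro _ ⟨_, ⟨B, rfl⟩, rfl⟩
    rw [aeval_X, coeffVec_apply]
    exact coeff_linSubst_eq_zero_of_notMem hd _)
  rwa [aeval_X] at h

/-- Restriction of a test polynomial on `k^ι` to the coordinates in a finite set `T` (the other
variables are set to `0`). [folklore] -/
def restrictToCoords {ι : Type*} [DecidableEq ι] (T : Finset ι) (P : MvPolynomial ι k) :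
    MvPolynomial T k :=
  aeval (fun d : ι => if h : d ∈ T then (X ⟨d, h⟩ : MvPolynomial T k) else 0) P

/-- Evaluating at a point supported in `T` factors through the restricted polynomial. [folklore] -/
private theorem aeval_comp_restrictToCoords {ι R : Type*} [CommRing R] [Algebra k R] [DecidableEq ι]
    (T : Finset ι) (x : ι → R) (hx : ∀ d ∉ T, x d = 0) (P : MvPolynomial ι k) :
    aeval (x ∘ ((↑) : T → ι)) (restrictToCoords T P) = aeval x P := by
  have hFG : (fun d : ι => aeval (x ∘ ((↑) : T → ι))
      (if h : d ∈ T then (X ⟨d, h⟩ : MvPolynomial T k) else 0)) = x := by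
    funext d
    split_ifs with h
    · rw [aeval_X]
      rfl
    · rw [map_zero, hx d h]
  rw [restrictToCoords, ← AlgHom.comp_apply, comp_aeval, hFG]

end Support

/-! ### § 2 Density: identities on `SL_n(k) · f` pass to `SL_n(K) · f_K` -/

section Density

variable {k K : Type*} [Field k] [Field K] [Algebra k K] {σ : Type*} [Fintype σ] [DecidableEq σ]

/-- The determinant of the generic matrix evaluates to the determinant (so `SL_n` is the zero set
of `det Y − 1` over every `k`-algebra). [cite: Milne2017AlgebraicGroups, §1.e (extension of scalars)] -/
theorem aeval_det_mvPolynomialX {S : Type*} [CommRing S] [Algebra k S] (A : Matrix σ σ S) :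
    aeval (fun ij : σ × σ => A ij.1 ij.2) (Matrix.mvPolynomialX σ σ k).det = A.det := by
  rw [AlgHom.map_det, Matrix.mvPolynomialX_mapMatrix_aeval]

omit [DecidableEq σ] in
/-- Over the base field, `genericCoeff f d` evaluates at `B` to `coeff d (B · f)` (`aeval` form of
`eval_genericCoeff`). [cite: MulmuleySohoniSIAM2001, §4] -/
theorem aeval_genericCoeff_self (f : MvPolynomial σ k) (d : σ →₀ ℕ) (B : Matrix σ σ k) :
    aeval (fun ij : σ × σ => B ij.1 ij.2) (genericCoeff f d) = coeff d (linSubst σ k B f) :=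
  eval_genericCoeff f d B

omit [DecidableEq σ] in
/-- Over the base field, `(p ∘ genericCoeff f)(B) = p(coeffVec (B · f))`.
[cite: MulmuleySohoniSIAM2001, §4] -/
theorem aeval_aeval_genericCoeff_self (f : MvPolynomial σ k) (p : MvPolynomial (σ →₀ ℕ) k)
    (B : Matrix σ σ k) :
    aeval (fun ij : σ × σ => B ij.1 ij.2) (aeval (genericCoeff f) p) =
      aeval (coeffVec (linSubst σ k B f)) p := by
  have h := aeval_aeval_genericCoeff (K := k) f p B
  rwa [Algebra.algebraMap_self, map_id] at h

/-- **`SL_n(k)` is dense in `SL_n(K)`** (`k` algebraically closed): a test polynomial over `k`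
vanishing on `coeffVec '' (SL_n(k) · f)` has base change vanishing on
`coeffVec '' (SL_n(K) · f_K)`. (Milne, Cor. 1.17 / A.48: `X(k)` is dense for `k` separably
closed; here through the Nullstellensatz on the hypersurface `det Y = 1`.)
[cite: Milne2017AlgebraicGroups, Cor. 1.17 / A.48] -/
theorem aeval_map_eq_zero_of_forall_slOrbit [IsAlgClosed k] {f : MvPolynomial σ k}
    {p : MvPolynomial (σ →₀ ℕ) k} (hp : ∀ h ∈ slOrbit σ k f, aeval (coeffVec h) p = 0)
    {h : MvPolynomial σ K} (hh : h ∈ slOrbit σ K (map (algebraMap k K) f)) :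
    aeval (coeffVec h) (map (algebraMap k K) p) = 0 := by
  obtain ⟨A, rfl⟩ := hh
  rw [aeval_map_algebraMap, ← aeval_aeval_genericCoeff]
  refine aeval_eq_zero_of_forall_zeroLocus (K := K)
    (Ideal.span {(Matrix.mvPolynomialX σ σ k).det - 1}) ?_ ?_
  · intro x hx
    rw [MvPolynomial.zeroLocus_span] at hx
    have hdet : (Matrix.of fun i j : σ => x (i, j)).det = 1 := by
      have h1 := hx _ (Set.mem_singleton _)
      rwa [map_sub, map_one, sub_eq_zero,
        show x = fun ij : σ × σ => (Matrix.of fun i j : σ => x (i, j)) ij.1 ij.2 from rfl,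
        aeval_det_mvPolynomialX] at h1
    rw [show x = fun ij : σ × σ => (Matrix.of fun i j : σ => x (i, j)) ij.1 ij.2 from rfl,
      aeval_aeval_genericCoeff_self]
    exact hp _ ⟨⟨_, hdet⟩, rfl⟩
  · rw [MvPolynomial.zeroLocus_span]
    intro q hq
    rw [Set.mem_singleton_iff] at hq
    rw [hq, map_sub, map_one, aeval_det_mvPolynomialX, Matrix.SpecialLinearGroup.det_coe, sub_self]

end Density

/-! ### § 3 Descent of polystability -/

section Descent

variable {k K : Type*} [Field k] [Field K] [Algebra k K] {σ : Type*} [Fintype σ] [DecidableEq σ]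

/-- **Polystability descends** (`k` algebraically closed): if the `SL_n(K)`-orbit of `f_K` is
closed then the `SL_n(k)`-orbit of `f` is closed. A point `v` of the closure of `SL_n(k)·f` maps
into the closure of `SL_n(K)·f_K` (ascent of Zariski closure), hence is `A · f_K` for some
`A ∈ SL_n(K)`; the system `{det Y = 1, coeff_d(Y·f) = v_d}` over `k` therefore has a solution
over `K`, hence one over `k` (weak Nullstellensatz). (GIT Ch. 1 §1 / Ch. 0 §2: geometric notions
and base change.) [cite: MumfordFogartyKirwan1994, Ch. 0 §2 (iv) / Ch. 1 §1] -/
theorem IsPolystable.of_map [IsAlgClosed k] {f : MvPolynomial σ k}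
    (h : IsPolystable (map (algebraMap k K) f)) : IsPolystable f := by
  classical
  intro v hv
  obtain ⟨_, ⟨A, rfl⟩, hA⟩ := h (comp_mem_zariskiClosure_slOrbit hv)
  let J : Ideal (MvPolynomial (σ × σ) k) := Ideal.span
    (insert ((Matrix.mvPolynomialX σ σ k).det - 1)
      ((fun d => genericCoeff f d - C (v d)) '' ↑(degreeSupportMonomials f)))
  have hy : (fun ij : σ × σ => (A : Matrix σ σ K) ij.1 ij.2) ∈ MvPolynomial.zeroLocus K J := by
    rw [MvPolynomial.zeroLocus_span]
    rintro q (rfl | ⟨d, -, rfl⟩)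
    · rw [map_sub, map_one, aeval_det_mvPolynomialX, Matrix.SpecialLinearGroup.det_coe, sub_self]
    · rw [map_sub, aeval_genericCoeff, aeval_C, ← coeffVec_apply (linSubst σ K _ _) d, hA, sub_self]
  obtain ⟨x, hx⟩ := exists_mem_zeroLocus_of_mem_zeroLocus J hy
  rw [MvPolynomial.zeroLocus_span] at hx
  set B : Matrix σ σ k := Matrix.of fun i j : σ => x (i, j) with hB
  have hxB : x = fun ij : σ × σ => B ij.1 ij.2 := rfl
  have hdet : B.det = 1 := by
    have h1 := hx _ (Set.mem_insert _ _)
    rwa [map_sub, map_one, sub_eq_zero, hxB, aeval_det_mvPolynomialX] at h1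
  have hcoeff : ∀ d ∈ degreeSupportMonomials f, coeff d (linSubst σ k B f) = v d := by
    intro d hd
    have h1 := hx _ (Set.mem_insert_of_mem _ ⟨d, hd, rfl⟩)
    rwa [map_sub, hxB, aeval_genericCoeff_self, aeval_C, Algebra.algebraMap_self, RingHom.id_apply,
      sub_eq_zero] at h1
  refine ⟨linSubst σ k B f, ⟨⟨B, hdet⟩, rfl⟩, ?_⟩
  funext d
  by_cases hd : d ∈ degreeSupportMonomials f
  · rw [coeffVec_apply, hcoeff d hd]
  · rw [coeffVec_apply, coeff_linSubst_eq_zero_of_notMem hd,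
      apply_eq_zero_of_mem_zariskiClosure_slOrbit hv hd]

end Descent

/-! ### § 4 The generic point specialises (commutative algebra) -/

section GenericPoint

variable {k K : Type*} [Field k] [Field K] [Algebra k K] {T τ : Type*}

/-- Evaluating a polynomial in the `T`-variables, renamed into `T ⊕ τ`, at a point `z`.
[folklore] -/
private theorem aeval_rename_inl {R : Type*} [CommRing R] [Algebra k R] (z : T ⊕ τ → R)
    (q : MvPolynomial T k) :
    aeval z (rename (Sum.inl : T → T ⊕ τ) q) = aeval (fun t => z (Sum.inl t)) q := by
  rw [aeval_rename]
  rfl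

/-- Evaluating a polynomial in the `τ`-variables, renamed into `T ⊕ τ`, at a point `z`.
[folklore] -/
private theorem aeval_rename_inr {R : Type*} [CommRing R] [Algebra k R] (z : T ⊕ τ → R)
    (q : MvPolynomial τ k) :
    aeval z (rename (Sum.inr : τ → T ⊕ τ) q) = aeval (fun i => z (Sum.inr i)) q := by
  rw [aeval_rename]
  rfl

/-- **Lifting a prime through an incidence correspondence.** Let `𝔭` be a prime of `k[T]` (`k`
algebraically closed, `T` finite) and `𝔟` an ideal of `k[T ⊕ τ]` such that every `k`-point of
`Z(𝔭)` is the `T`-part of a `k`-point of `Z(𝔟)`. Then some prime `𝔔 ⊇ 𝔟` of `k[T ⊕ τ]`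
contracts to `𝔭`. Proof: `Ideal.exists_le_prime_disjoint` for `𝔟 + 𝔭^e` and the image of
`k[T] ∖ 𝔭`; an `s ∉ 𝔭` in `𝔟 + 𝔭^e` would vanish at every `k`-point of `Z(𝔭)`, i.e. lie in
`I(Z(𝔭)) = 𝔭` (Nullstellensatz). (Atiyah–Macdonald Thm. 5.10 is the integral case; here the
lifting hypothesis replaces integrality.) [cite: AtiyahMacdonald1969, Thm. 5.10 / Ex. 7.14] -/
theorem exists_isPrime_le_comap_eq [IsAlgClosed k] [Finite T] (𝔭 : Ideal (MvPolynomial T k))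
    [𝔭.IsPrime] (𝔟 : Ideal (MvPolynomial (T ⊕ τ) k))
    (hlift : ∀ y ∈ MvPolynomial.zeroLocus k 𝔭, ∃ z ∈ MvPolynomial.zeroLocus k 𝔟,
      (fun t => z (Sum.inl t)) = y) :
    ∃ 𝔔 : Ideal (MvPolynomial (T ⊕ τ) k), 𝔔.IsPrime ∧ 𝔟 ≤ 𝔔 ∧
      𝔔.comap (rename (Sum.inl : T → T ⊕ τ)).toRingHom = 𝔭 := by
  classical
  set ι₁ : MvPolynomial T k →+* MvPolynomial (T ⊕ τ) k :=
    (rename (Sum.inl : T → T ⊕ τ)).toRingHom with hι₁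
  have hι₁_apply : ∀ q, ι₁ q = rename (Sum.inl : T → T ⊕ τ) q := fun q => rfl
  let M : Submonoid (MvPolynomial (T ⊕ τ) k) := 𝔭.primeCompl.map ι₁
  have hdisj : Disjoint ((𝔟 ⊔ 𝔭.map ι₁ : Ideal (MvPolynomial (T ⊕ τ) k)) :
      Set (MvPolynomial (T ⊕ τ) k)) (M : Set (MvPolynomial (T ⊕ τ) k)) := by
    rw [Set.disjoint_left]
    rintro b hb ⟨s, hs, rfl⟩
    apply hs
    -- `s ∈ 𝔭`: it vanishes at every `k`-point of `Z(𝔭)`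
    have key : s ∈ MvPolynomial.vanishingIdeal k (MvPolynomial.zeroLocus k 𝔭) := by
      rw [MvPolynomial.mem_vanishingIdeal_iff]
      intro y hy
      obtain ⟨z, hz, hzy⟩ := hlift y hy
      have hz𝔭 : z ∈ MvPolynomial.zeroLocus k (𝔭.map ι₁) := by
        rw [Ideal.map, MvPolynomial.zeroLocus_span]
        rintro _ ⟨q, hq, rfl⟩
        rw [hι₁_apply, aeval_rename_inl, hzy]
        exact (MvPolynomial.mem_zeroLocus_iff.mp hy) q hq
      have hzb : aeval z (ι₁ s) = 0 := by
        obtain ⟨b₁, hb₁, b₂, hb₂, hsum⟩ := Submodule.mem_sup.mp hb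
        rw [← hsum, map_add, (MvPolynomial.mem_zeroLocus_iff.mp hz) b₁ hb₁,
          (MvPolynomial.mem_zeroLocus_iff.mp hz𝔭) b₂ hb₂, add_zero]
      rwa [hι₁_apply, aeval_rename_inl, hzy] at hzb
    rwa [MvPolynomial.IsPrime.vanishingIdeal_zeroLocus (K := k) 𝔭] at key
  obtain ⟨𝔔, h𝔔, hle, hdis⟩ := Ideal.exists_le_prime_disjoint _ M hdisj
  refine ⟨𝔔, h𝔔, le_sup_left.trans hle, le_antisymm ?_ ?_⟩
  · intro a ha
    by_contra hna
    exact Set.disjoint_left.mp hdis (Ideal.mem_comap.mp ha) ⟨a, hna, rfl⟩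
  · exact Ideal.map_le_iff_le_comap.mp (le_sup_right.trans hle)

/-- **The generic point specialises.** Let `k ⊆ K` be algebraically closed fields, `T`, `τ`
finite, `G₀` a set of polynomials and `c : T → k[τ]` a family of polynomials over `k` in the
`τ`-variables, and `w : T → K`. Suppose every `k`-SPECIALISATION `y` of `w` (every `y ∈ k^T` at
which all polynomials over `k` vanishing at `w` vanish) lifts: there is `b ∈ k^τ` with `g(b) = 0`
(`g ∈ G₀`) and `c_d(b) = y_d`. Then `w` itself lifts to a `K`-point: some `a ∈ K^τ` has
`g(a) = 0` (`g ∈ G₀`) and `c_d(a) = w_d`. Proof: lift the prime `𝔭 = ker(ev_w)` to a prime `𝔔`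
of the incidence ring (`exists_isPrime_le_comap_eq`); over the fraction field `M` of `k[T]/𝔭`
(which embeds into `K` by `ev_w` and into `L = Frac(k[T ⊕ τ]/𝔔)`) the fibre ideal
`{g = 0, c_d = w_d}` has an `L`-point, so it is proper, so it has a `K`-point (Nullstellensatz
over `M` with points in the algebraically closed `K`). (Weil's specialisation / extension of
specialisations; GIT Ch. 0 §2.) [cite: MumfordFogartyKirwan1994, Ch. 0 §2 (iv)] -/
theorem exists_aeval_eq_of_forall_lift [IsAlgClosed k] [IsAlgClosed K] [Finite T] [Finite τ]
    (G₀ : Set (MvPolynomial τ k)) (c : T → MvPolynomial τ k) (w : T → K)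
    (hlift : ∀ y : T → k, (∀ q : MvPolynomial T k, aeval w q = 0 → aeval y q = 0) →
      ∃ b : τ → k, (∀ g ∈ G₀, aeval b g = 0) ∧ ∀ d, aeval b (c d) = y d) :
    ∃ a : τ → K, (∀ g ∈ G₀, aeval a g = 0) ∧ ∀ d, aeval a (c d) = w d := by
  classical
  -- the rings
  set A := MvPolynomial T k with hA
  set B := MvPolynomial (T ⊕ τ) k with hB
  set ι₁ : A →+* B := (rename (Sum.inl : T → T ⊕ τ)).toRingHom with hι₁
  set ι₂ : MvPolynomial τ k →+* B := (rename (Sum.inr : τ → T ⊕ τ)).toRingHom with hι₂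
  have hι₁_apply : ∀ q, ι₁ q = rename (Sum.inl : T → T ⊕ τ) q := fun q => rfl
  have hι₂_apply : ∀ q, ι₂ q = rename (Sum.inr : τ → T ⊕ τ) q := fun q => rfl
  set ψ : A →ₐ[k] K := aeval w with hψ
  set 𝔭 : Ideal A := RingHom.ker ψ.toRingHom with h𝔭
  haveI h𝔭prime : 𝔭.IsPrime := RingHom.ker_isPrime _
  -- the incidence ideal
  set 𝔟 : Ideal B := Ideal.span (ι₂ '' G₀ ∪ Set.range fun d : T => ι₂ (c d) - X (Sum.inl d))
    with h𝔟
  -- (1) lift the prime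
  have hlift' : ∀ y ∈ MvPolynomial.zeroLocus k 𝔭, ∃ z ∈ MvPolynomial.zeroLocus k 𝔟,
      (fun t => z (Sum.inl t)) = y := by
    intro y hy
    obtain ⟨b, hbG, hbc⟩ := hlift y (fun q hq => (MvPolynomial.mem_zeroLocus_iff.mp hy) q
      (by rwa [h𝔭, RingHom.mem_ker]))
    refine ⟨Sum.elim y b, ?_, rfl⟩
    rw [h𝔟, MvPolynomial.zeroLocus_span]
    rintro q (⟨g, hg, rfl⟩ | ⟨d, rfl⟩)
    · rw [hι₂_apply, aeval_rename_inr]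
      exact hbG g hg
    · rw [map_sub, hι₂_apply, aeval_rename_inr, aeval_X]
      change aeval b (c d) - y d = 0
      rw [hbc d, sub_self]
  obtain ⟨𝔔, h𝔔, h𝔟𝔔, hcomap⟩ := exists_isPrime_le_comap_eq 𝔭 𝔟 hlift'
  haveI := h𝔔
  -- (2) residue domains and fraction fields
  have hker : ∀ x ∈ 𝔟, Ideal.Quotient.mk 𝔔 x = 0 := fun x hx =>
    Ideal.Quotient.eq_zero_iff_mem.mpr (h𝔟𝔔 hx)
  set R₀ := A ⧸ 𝔭 with hR₀
  set D := B ⧸ 𝔔 with hD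
  set e₀ : R₀ →+* K := RingHom.kerLift ψ.toRingHom with he₀
  have he₀inj : Function.Injective e₀ := RingHom.kerLift_injective _
  set j : R₀ →+* D := Ideal.quotientMap 𝔔 ι₁ (le_of_eq hcomap.symm) with hj
  have hjinj : Function.Injective j := Ideal.quotientMap_injective' (le_of_eq hcomap)
  set M := FractionRing R₀ with hM
  set L := FractionRing D with hL
  set eMK : M →+* K := IsFractionRing.lift he₀inj with heMK
  have hjL : Function.Injective ((algebraMap D L).comp j) :=
    (IsFractionRing.injective D L).comp hjinj
  set eML : M →+* L := IsFractionRing.lift hjL with heML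
  letI algMK : Algebra M K := eMK.toAlgebra
  letI algML : Algebra M L := eML.toAlgebra
  have halgMK : algebraMap M K = eMK := rfl
  have halgML : algebraMap M L = eML := rfl
  set θ : k →+* M := (algebraMap R₀ M).comp ((Ideal.Quotient.mk 𝔭).comp (C : k →+* A)) with hθ
  set m : T → M := fun d => algebraMap R₀ M (Ideal.Quotient.mk 𝔭 (X d)) with hm
  set Θ : B →+* L := (algebraMap D L).comp (Ideal.Quotient.mk 𝔔) with hΘ
  set Xbar : τ → L := fun i => Θ (X (Sum.inr i)) with hXbar
  have hΘ𝔟 : ∀ x ∈ 𝔟, Θ x = 0 := fun x hx => by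
    rw [hΘ, RingHom.comp_apply, hker x hx, map_zero]
  -- (3) compatibilities
  have hθL : ∀ c : k, eML (θ c) = Θ (C c) := by
    intro c
    show eML (algebraMap R₀ M (Ideal.Quotient.mk 𝔭 (C c))) =
      algebraMap D L (Ideal.Quotient.mk 𝔔 (C c))
    rw [heML, IsFractionRing.lift_algebraMap, RingHom.comp_apply, hj, Ideal.quotientMap_mk,
      hι₁_apply, rename_C]
  have hmL : ∀ d, eML (m d) = Θ (X (Sum.inl d)) := by
    intro d
    show eML (algebraMap R₀ M (Ideal.Quotient.mk 𝔭 (X d))) =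
      algebraMap D L (Ideal.Quotient.mk 𝔔 (X (Sum.inl d)))
    rw [heML, IsFractionRing.lift_algebraMap, RingHom.comp_apply, hj, Ideal.quotientMap_mk,
      hι₁_apply, rename_X]
  have hΘι₂ : ∀ q : MvPolynomial τ k, Θ (ι₂ q) = aeval Xbar (map θ q) := by
    intro q
    have hext : Θ.comp ι₂ = eval₂Hom (Θ.comp (C : k →+* B)) Xbar := by
      refine MvPolynomial.ringHom_ext (fun r => ?_) (fun i => ?_)
      · rw [eval₂Hom_C]
        show Θ (ι₂ (C r)) = Θ (C r)
        rw [hι₂_apply, rename_C]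
      · rw [eval₂Hom_X']
        show Θ (ι₂ (X i)) = Xbar i
        rw [hι₂_apply, rename_X]
    have h1 : Θ (ι₂ q) = eval₂ (Θ.comp (C : k →+* B)) Xbar q := by
      rw [← RingHom.comp_apply, hext, coe_eval₂Hom]
    have hcomp : (algebraMap M L).comp θ = Θ.comp (C : k →+* B) :=
      RingHom.ext fun r => by
        show algebraMap M L (θ r) = Θ (C r)
        rw [halgML, hθL]
    rw [h1, aeval_def, eval₂_map, hcomp]
  have hθK : ∀ c : k, eMK (θ c) = algebraMap k K c := by
    intro c
    show eMK (algebraMap R₀ M (Ideal.Quotient.mk 𝔭 (C c))) = algebraMap k K c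
    rw [heMK, IsFractionRing.lift_algebraMap, he₀]
    show ψ.toRingHom (C c) = algebraMap k K c
    rw [AlgHom.toRingHom_eq_coe, RingHom.coe_coe, hψ, aeval_C]
  have hmK : ∀ d, eMK (m d) = w d := by
    intro d
    show eMK (algebraMap R₀ M (Ideal.Quotient.mk 𝔭 (X d))) = w d
    rw [heMK, IsFractionRing.lift_algebraMap, he₀]
    show ψ.toRingHom (X d) = w d
    rw [AlgHom.toRingHom_eq_coe, RingHom.coe_coe, hψ, aeval_X]
  have haevalK : ∀ (a : τ → K) (q : MvPolynomial τ k), aeval a (map θ q) = aeval a q := by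
    intro a q
    have hcomp : (algebraMap M K).comp θ = algebraMap k K :=
      RingHom.ext fun r => by
        show algebraMap M K (θ r) = algebraMap k K r
        rw [halgMK, hθK]
    rw [aeval_def, eval₂_map, hcomp, ← aeval_def]
  -- (4) the fibre ideal over `M`, its `L`-point, its properness
  set 𝔟M : Ideal (MvPolynomial τ M) :=
    Ideal.span ((fun g => map θ g) '' G₀ ∪ Set.range fun d : T => map θ (c d) - C (m d)) with h𝔟M
  have hXbar : Xbar ∈ MvPolynomial.zeroLocus L 𝔟M := by
    rw [h𝔟M, MvPolynomial.zeroLocus_span]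
    rintro q (⟨g, hg, rfl⟩ | ⟨d, rfl⟩)
    · rw [← hΘι₂]
      exact hΘ𝔟 _ (Ideal.subset_span (Or.inl ⟨g, hg, rfl⟩))
    · rw [map_sub, ← hΘι₂, aeval_C, halgML, hmL, ← map_sub]
      exact hΘ𝔟 _ (Ideal.subset_span (Or.inr ⟨d, rfl⟩))
  have hne : 𝔟M ≠ ⊤ := by
    intro htop
    rw [htop, MvPolynomial.zeroLocus_top] at hXbar
    exact hXbar
  -- (5) a `K`-point of the fibre ideal
  obtain ⟨a, ha⟩ := nonempty_zeroLocus_of_ne_top (K := K) hne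
  rw [h𝔟M, MvPolynomial.zeroLocus_span] at ha
  refine ⟨a, fun g hg => ?_, fun d => ?_⟩
  · have h1 := ha _ (Or.inl ⟨g, hg, rfl⟩)
    rwa [haevalK] at h1
  · have h1 := ha _ (Or.inr ⟨d, rfl⟩)
    rwa [map_sub, haevalK, aeval_C, halgMK, hmK, sub_eq_zero] at h1

end GenericPoint

/-! ### § 5 Ascent of polystability -/

section Ascent

variable {k K : Type*} [Field k] [Field K] [Algebra k K] {σ : Type*} [Fintype σ] [DecidableEq σ]

/-- **Polystability ascends** (`k`, `K` algebraically closed): if the `SL_n(k)`-orbit of `f` is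
Zariski closed in coefficient space over `k`, then the `SL_n(K)`-orbit of `f_K` is Zariski closed
over `K`. Proof: a point `w` of the closure of `SL_n(K)·f_K` is supported on `degreeSupportMonomials f`;
apply `exists_aeval_eq_of_forall_lift` to the incidence system `{det Y = 1, coeff_d(Y·f) = w_d}`:
a `k`-specialisation `y` of `w` lies in the closure of `SL_n(k)·f` (a test polynomial vanishing on
`SL_n(k)·f` has base change vanishing on `SL_n(K)·f_K` by density, hence at `w`, hence its
`T`-restriction lies in `ker(ev_w)`), so by polystability over `k` it IS a point `B·f`,
`B ∈ SL_n(k)` — the required lift. The resulting `K`-point `A` has `det A = 1` and `A·f_K = w`.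
(GIT Ch. 1 §1 with Ch. 0 §2 (iv): closedness of orbits is a geometric property.)
[cite: MumfordFogartyKirwan1994, Ch. 0 §2 (iv) / Ch. 1 §1] -/
theorem IsPolystable.map [IsAlgClosed k] [IsAlgClosed K] {f : MvPolynomial σ k}
    (hf : IsPolystable f) : IsPolystable (MvPolynomial.map (algebraMap k K) f) := by
  classical
  intro w hw
  set T := degreeSupportMonomials f with hT
  -- every `k`-specialisation of `w|_T` lifts to an `SL_n(k)`-translate of `f`
  have hlift : ∀ y : T → k,
      (∀ q : MvPolynomial T k, aeval (w ∘ ((↑) : T → (σ →₀ ℕ))) q = 0 → aeval y q = 0) →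
      ∃ b : σ × σ → k, (∀ g ∈ ({(Matrix.mvPolynomialX σ σ k).det - 1} : Set (MvPolynomial (σ × σ) k)),
        aeval b g = 0) ∧ ∀ d : T, aeval b (genericCoeff f (d : σ →₀ ℕ)) = y d := by
    intro y hy
    -- the extension of `y` by zero lies in the closure of `SL_n(k) · f`
    set yt : (σ →₀ ℕ) → k := fun d => if h : d ∈ T then y ⟨d, h⟩ else 0 with hyt
    have hyt0 : ∀ d ∉ T, yt d = 0 := fun d hd => by rw [hyt]; exact dif_neg hd
    have hytT : yt ∘ ((↑) : T → (σ →₀ ℕ)) = y := by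
      funext t
      rw [Function.comp_apply, hyt]
      exact dif_pos t.2
    have hmem : yt ∈ zariskiClosure (coeffVec '' slOrbit σ k f) := by
      rw [mem_zariskiClosure_iff]
      intro P hP
      -- the restriction of `P` to the `T`-coordinates vanishes on `SL_n(k) · f`
      have hPt : ∀ h ∈ slOrbit σ k f,
          aeval (coeffVec h) (rename ((↑) : T → (σ →₀ ℕ)) (restrictToCoords T P)) = 0 := by
        rintro _ ⟨B, rfl⟩
        rw [aeval_rename, aeval_comp_restrictToCoords T _ (fun d hd => by
          rw [coeffVec_apply]; exact coeff_linSubst_eq_zero_of_notMem hd _) P]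
        exact hP _ ⟨_, ⟨B, rfl⟩, rfl⟩
      -- by density its base change vanishes on `SL_n(K) · f_K`, hence at `w`
      have hw' := (mem_zariskiClosure_iff.mp hw) (MvPolynomial.map (algebraMap k K)
        (rename ((↑) : T → (σ →₀ ℕ)) (restrictToCoords T P))) (by
          rintro _ ⟨h, hh, rfl⟩
          exact aeval_map_eq_zero_of_forall_slOrbit hPt hh)
      rw [aeval_map_algebraMap, aeval_rename] at hw'
      -- so the restriction lies in `ker(ev_w)` and vanishes at `y`
      rw [← aeval_comp_restrictToCoords T yt hyt0 P, hytT]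
      exact hy _ hw'
    obtain ⟨_, ⟨B, rfl⟩, hB⟩ := hf hmem
    refine ⟨fun ij => (B : Matrix σ σ k) ij.1 ij.2, fun g hg => ?_, fun d => ?_⟩
    · rw [Set.mem_singleton_iff] at hg
      rw [hg, map_sub, map_one, aeval_det_mvPolynomialX, Matrix.SpecialLinearGroup.det_coe, sub_self]
    · rw [aeval_genericCoeff_self, ← coeffVec_apply (linSubst σ k _ f), hB, hyt]
      exact dif_pos d.2
  -- the generic point specialises: an `SL_n(K)`-matrix `A` with `A · f_K = w`
  obtain ⟨a, hadet, hac⟩ := exists_aeval_eq_of_forall_lift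
    ({(Matrix.mvPolynomialX σ σ k).det - 1} : Set (MvPolynomial (σ × σ) k))
    (fun d : T => genericCoeff f (d : σ →₀ ℕ)) (w ∘ ((↑) : T → (σ →₀ ℕ))) hlift
  set A : Matrix σ σ K := Matrix.of fun i j : σ => a (i, j) with hAdef
  have haA : a = fun ij : σ × σ => A ij.1 ij.2 := rfl
  have hdet : A.det = 1 := by
    have h1 := hadet _ (Set.mem_singleton _)
    rwa [map_sub, map_one, sub_eq_zero, haA, aeval_det_mvPolynomialX] at h1
  refine ⟨linSubst σ K A (MvPolynomial.map (algebraMap k K) f), ⟨⟨A, hdet⟩, rfl⟩, ?_⟩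
  funext d
  by_cases hd : d ∈ T
  · have h1 := hac ⟨d, hd⟩
    rw [haA, aeval_genericCoeff] at h1
    rw [coeffVec_apply, h1]
    rfl
  · have hd' : d ∉ degreeSupportMonomials (MvPolynomial.map (algebraMap k K) f) := by
      rwa [degreeSupportMonomials_map]
    rw [coeffVec_apply, coeff_linSubst_eq_zero_of_notMem hd',
      apply_eq_zero_of_mem_zariskiClosure_slOrbit hw hd']

/-- **Polystability is invariant under extension of algebraically closed scalars.**
[cite: MumfordFogartyKirwan1994, Ch. 0 §2 (iv) / Ch. 1 §1] -/
theorem isPolystable_map_iff [IsAlgClosed k] [IsAlgClosed K] (f : MvPolynomial σ k) :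
    IsPolystable (MvPolynomial.map (algebraMap k K) f) ↔ IsPolystable f :=
  ⟨IsPolystable.of_map, IsPolystable.map⟩

end Ascent

end Literature.Computability.AlgebraicComplexity

end
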